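import Literature.NumberTheory.Automorphic.AdelicGroupData
import Literature.NumberTheory.Automorphic.AdicCompletionCompact
import HarnessLib

/-!
# `GL_n(𝔸_K)` is locally compact — discharge of `AdelicGroupData.locallyCompactSpace_gl_adelic`

Trunk `AutomorphicAxiomatic` (G19), topic `NumberTheory/Automorphic`; namespace `Literature.Automorphic`.
Sibling proof file of `Literature.NumberTheory.Automorphic.AdelicGroupData`: it discharges,
sorry-free, the named fact

* `AdelicGroupData.locallyCompactSpace_gl_adelic n K` : the group `GL_n(𝔸_K) = (gl n K).Adelic` of
  adelic points of `GL_n` over a number field `K` (Mathlib's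
  `Matrix.GeneralLinearGroup (Fin n) (NumberField.AdeleRing (𝓞 K) K)` with the units topology,
  i.e. the topology induced by `g ↦ (g, g⁻¹)` into `M_n(𝔸_K) × M_n(𝔸_K)ᵐᵒᵖ`) is locally compact,

as `AdelicGroupData.locallyCompactSpace_gl_adelic_holds`.

The argument is that of Platonov–Rapinchuk, *Algebraic Groups and Number Theory*, §5.1: the adele
ring `𝔸_K` is a locally compact (Hausdorff) topological ring, and for an affine `K`-group
`G ↪ 𝔸^N` given by closed conditions the adelic points `G_𝔸` form a locally compact group; for
`G = GL_n` one uses the closed embedding `GL_n ↪ M_n × M_n`, `g ↦ (g, g⁻¹)` (equivalently Bump,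
*Automorphic Forms and Representations*, §3.3: `GL(n, 𝔸)` is the restricted product of the
`GL(n, K_v)` with respect to the compact open `GL(n, 𝒪_v)`, topologised via `g ↦ (g, det g⁻¹)`).
In Lean:

* `𝔸_K = K_∞ × ∏'_v (K_v : 𝒪_v)` is locally compact — this is
  `Literature.NumberTheory.Automorphic.locallyCompactSpace_adeleRing'` of
  `Literature.NumberTheory.Automorphic.AdicCompletionCompact` (every `𝒪_v` is compact open:
  complete, discretely valued, finite residue field; `K_∞` is locally compact in Mathlib);
* `𝔸_K` is Hausdorff (Mathlib instances on `K_∞ = Π_w K_w`, on the restricted product and on binary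
  products; re-derived inline below, cf. `Literature.NumberTheory.Automorphic.t2Space_adeleRing` of
  `QuaternionAlgebraAdelicProofs`);
* `M_n(𝔸_K) = 𝔸_K^{n × n}` is locally compact (finite product), and the unit group of a locally
  compact Hausdorff topological monoid is locally compact for the units topology (Mathlib's
  `LocallyCompactSpace αˣ` instance of `Mathlib.Topology.Algebra.Group.Basic`, from the closed
  embedding `Units.isClosedEmbedding_embedProduct`).

The general statements are `locallyCompactSpace_matrix_adeleRing` and
`locallyCompactSpace_generalLinearGroup_adeleRing` (any finite index type, any universe); the
discharge specialises to `Fin n` and `K : Type`, the signature of the named fact. All results are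
theorems, not instances (no Mathlib instance is duplicated); users feed
`locallyCompactSpace_gl_adelic_holds n K` to hypotheses `(h : locallyCompactSpace_gl_adelic n K)`,
and `locallyCompactSpace_generalLinearGroup_adeleRing K (Fin n)` to instance hypotheses
`[LocallyCompactSpace (GL (Fin n) (AdeleRing (𝓞 K) K))]`.

## References

* V. Platonov, A. Rapinchuk, *Algebraic Groups and Number Theory*, Pure and Applied Mathematics
  139, Academic Press (1994), §5.1 (adele groups of algebraic groups are locally compact).
* D. Bump, *Automorphic Forms and Representations*, Cambridge Studies in Advanced Mathematics 55
  (1997), §3.3, pp. 285–286 (restricted products w.r.t. compact open subgroups; `GL(n, 𝔸)`).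
* J. W. S. Cassels, *Local Fields*, LMS Student Texts 3 (1986), Ch. 4, Lemma 1.5 and Corollary
  (`𝒪_v` compact, `K_v` locally compact).
-/

noncomputable section

open NumberField IsDedekindDomain

open scoped RestrictedProduct

namespace Literature.NumberTheory.Automorphic

namespace AdelicGroupData

section General

variable (K : Type*) [Field K] [NumberField K] (ι : Type*) [Fintype ι]

/-- `M_ι(𝔸_K) = 𝔸_K^{ι × ι}` is locally compact for a finite index type `ι`: a finite product of
copies of the locally compact adele ring (`Literature.NumberTheory.Automorphic.locallyCompactSpace_adeleRing'`;
Platonov–Rapinchuk §5.1). [folklore] -/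
theorem locallyCompactSpace_matrix_adeleRing :
    LocallyCompactSpace (Matrix ι ι (AdeleRing (𝓞 K) K)) :=
  haveI := locallyCompactSpace_adeleRing' K
  inferInstanceAs <| LocallyCompactSpace (ι → ι → AdeleRing (𝓞 K) K)

/-- **`GL_ι(𝔸_K)` is locally compact** (units topology): `𝔸_K` is a locally compact Hausdorff
ring, so `M_ι(𝔸_K)` is a locally compact Hausdorff topological monoid, and its unit group is closed
in `M_ι(𝔸_K) × M_ι(𝔸_K)ᵐᵒᵖ` under `g ↦ (g, g⁻¹)` (Mathlib `Units.isClosedEmbedding_embedProduct`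
and its `LocallyCompactSpace αˣ` instance). Platonov–Rapinchuk, *Algebraic Groups and Number
Theory*, §5.1; Bump, *Automorphic Forms and Representations*, §3.3.
[cite: PlatonovRapinchuk1994, §5.1 (adele groups are locally compact)] -/
theorem locallyCompactSpace_generalLinearGroup_adeleRing [DecidableEq ι] :
    LocallyCompactSpace (GL ι (AdeleRing (𝓞 K) K)) := by
  -- `𝔸_K = K_∞ × ∏'_v (K_v : 𝒪_v)` is Hausdorff (Mathlib instances on the components).
  haveI : T2Space (FiniteAdeleRing (𝓞 K) K) := inferInstanceAs <| T2Space
    (Πʳ w : HeightOneSpectrum (𝓞 K), [w.adicCompletion K, w.adicCompletionIntegers K])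
  haveI : T2Space (InfiniteAdeleRing K) :=
    inferInstanceAs <| T2Space ((w : InfinitePlace K) → w.Completion)
  haveI : T2Space (AdeleRing (𝓞 K) K) :=
    inferInstanceAs <| T2Space (InfiniteAdeleRing K × FiniteAdeleRing (𝓞 K) K)
  haveI := locallyCompactSpace_matrix_adeleRing K ι
  infer_instance

end General

section Discharge

/-- **Discharge** of `locallyCompactSpace_gl_adelic`: `GL_n(𝔸_K) = (gl n K).Adelic` is locally
compact (Platonov–Rapinchuk, *Algebraic Groups and Number Theory*, §5.1: `𝔸_K` is a locally
compact ring and `GL_n ↪ M_n × M_n`, `g ↦ (g, g⁻¹)`, is a closed embedding), by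
`locallyCompactSpace_generalLinearGroup_adeleRing` at `ι = Fin n`.
[cite: PlatonovRapinchuk1994, §5.1 (adele groups are locally compact)] -/
theorem locallyCompactSpace_gl_adelic_holds (n : ℕ) (K : Type) [Field K] [NumberField K] :
    locallyCompactSpace_gl_adelic n K :=
  locallyCompactSpace_generalLinearGroup_adeleRing K (Fin n)

end Discharge

end AdelicGroupData

end Literature.NumberTheory.Automorphic

end
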